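import Literature.NumberTheory.EllipticCurves.AnalyticRankLSeriesSummableProofs
import Literature.NumberTheory.EllipticCurves.HasseElementary
import Literature.NumberTheory.EllipticCurves.LFunctionPrimeCoeff
import Literature.NumberTheory.EllipticCurves.ModularityVersionAp
import Mathlib.FieldTheory.Finite.Basic
import HarnessLib

/-!
# The Ramanujan–Hasse bound `|aₙ(E)| ≤ d(n) √n ≤ 16²⁵⁶ n^{5/8}` for elliptic curves over `ℚ`

Topic `NumberTheory/EllipticCurves` (trunk EllArithM; companion of
`AnalyticRankLSeriesSummableProofs` and `LFunctionPrimeCoeff`). For an elliptic curve `E / ℚ`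
(a `WeierstrassCurve ℚ` with `IsElliptic`), the Dirichlet coefficients `aₙ(E)` of Mathlib's
`WeierstrassCurve.LFunction` (the Euler product `∏_p L_p(p⁻ˢ)⁻¹`, Silverman *AEC* §C.16)
satisfy the pointwise Ramanujan-type bound

* `WeierstrassCurve.abs_LFunction_le_rpow`: `|aₙ(E)| ≤ 16^{256} · n^{5/8}` for all `n`,

**unconditionally**. Ingredients, all proved here or in the tree:

1. `isMultiplicative_LFunction` and `LFunction_apply_prime_pow` (`ModularityVersionAp`): the
   coefficients are multiplicative and `a_{p^k}` is the `k`-th coefficient of `1 / L_p(T)`.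
2. `abs_natCard_point_sub_le_of_card_eq_prime`: **Hasse's bound `|#E(𝔽_p) - (p+1)| ≤ 2√p` at
   every prime `p`** — for `p ≥ 5` this is the elementary (Manin) proof of Hasse's theorem in
   `HasseElementary` (`abs_natCard_point_sub_le_of_ringChar_ne`), and for `p ∈ {2, 3}` it is
   implied by the trivial bounds `1 ≤ #E(𝔽_p) ≤ 2p + 1`. (Only prime fields occur as residue
   fields of `ℚ`, so the named fact `Literature.NumberTheory.LFunctions.hasse_bound` is not needed.)
3. `abs_LFunction_prime_pow_le`: hence `|a_{p^k}| ≤ (k + 1) p^{k/2}` at every `p`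
   (`abs_coeff_localPowerSeries_le` of `AnalyticRankLSeriesSummableProofs`), i.e.
   `|aₙ| ≤ d(n) √n`.
4. `succ_mul_sqrt_pow_le`: `(k + 1) p^{k/2} ≤ B_p (p^k)^{5/8}` with `B_p = 16` for `p < 256`
   and `B_p = 1` for `p ≥ 256` (`(k+1)^8 ≤ 2^{k+32}`), so the divisor function is absorbed
   into `n^{1/8}` with the constant `16^{256}`.

The exponent `5/8 < 2/3` is what the first-moment non-vanishing theorem for `L(f ⊗ χ, 1)`
(`PAdicLFunctionMomentProofs.exists_wildChars_twistedSymbolSum_ne_zero`) requires of the newform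
`f` of `E` (whose coefficients are the `aₙ(E)`, `IsNewformOf`).

## References

* J. H. Silverman, *The Arithmetic of Elliptic Curves*, 2nd ed., GTM 106, Thm. V.1.1 (Hasse)
  and App. C §16 (the `L`-series and its coefficients).
* A. W. Knapp, *Elliptic Curves*, Princeton 1992, Thm. 10.5 (Manin's elementary proof of Hasse's
  theorem, as formalised in `HasseElementary`).
-/

noncomputable section

open scoped BigOperators
open ArithmeticFunction IsDedekindDomain NumberField

universe u

namespace WeierstrassCurve

section Rat

open Rat.HeightOneSpectrum

variable (v : HeightOneSpectrum (𝓞 ℚ))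

/-! ### The Hasse bound at every prime of `ℚ` (trivial at `2, 3`) and the local coefficient bound -/

/-- A finite field with a prime number `p` of elements has characteristic `p`. [folklore] -/
theorem ringChar_eq_of_card_eq_prime {F : Type*} [Field F] [Fintype F] {p : ℕ} (hp : p.Prime)
    (hF : Fintype.card F = p) : ringChar F = p := by
  haveI := ringChar.charP F
  obtain ⟨n, hr, hn⟩ := FiniteField.card F (ringChar F)
  rw [hF] at hn
  have hdvd : ringChar F ∣ p := hn ▸ dvd_pow_self _ n.ne_zero
  exact (Nat.prime_dvd_prime_iff_eq hr hp).mp hdvd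

/-- **Hasse's bound at every prime of `ℚ`.** For an elliptic curve over a finite *prime* field
`𝔽_p`, `|#E(𝔽_p) - (p + 1)| ≤ 2√p`: for `p ≥ 5` this is Hasse's theorem in the elementary form
proved in `HasseElementary` (`abs_natCard_point_sub_le_of_ringChar_ne`, Manin's proof), and for
`p ≤ 4` it is implied by the trivial bounds `1 ≤ #E(𝔽_p) ≤ 2p + 1` (`|a_p| ≤ p ≤ 2√p`).
[folklore] -/
theorem abs_natCard_point_sub_le_of_card_eq_prime {F : Type u} [Field F] [Fintype F]
    (E : WeierstrassCurve F) [E.IsElliptic] {p : ℕ} (hp : p.Prime) (hF : Fintype.card F = p) :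
    |(Nat.card E.toAffine.Point : ℝ) - (Fintype.card F + 1)| ≤ 2 * Real.sqrt (Fintype.card F) := by
  by_cases h4 : Fintype.card F ≤ 4
  · -- trivial: `|a| ≤ q ≤ 2√q` for `q ≤ 4`
    have h := E.abs_card_add_one_sub_natCard_point_le
    have hq0 : (0 : ℝ) ≤ Fintype.card F := Nat.cast_nonneg _
    have hq4 : (Fintype.card F : ℝ) ≤ 4 := by exact_mod_cast h4
    have hsq : (Fintype.card F : ℝ) ≤ 2 * Real.sqrt (Fintype.card F) := by
      have hs := Real.sq_sqrt hq0
      have hs0 := Real.sqrt_nonneg (Fintype.card F : ℝ)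
      nlinarith [Real.sqrt_le_sqrt hq4, show Real.sqrt 4 = 2 by
        rw [show (4 : ℝ) = 2 ^ 2 by norm_num, Real.sqrt_sq (by norm_num)]]
    have h' : |(Nat.card E.toAffine.Point : ℝ) - (Fintype.card F + 1)| ≤ Fintype.card F := by
      rw [abs_sub_comm]
      have := (Int.cast_le (R := ℝ)).mpr h
      push_cast [Int.cast_abs] at this
      exact this
    exact h'.trans hsq
  · push Not at h4
    rw [hF] at h4
    have h2 : ringChar F ≠ 2 := by rw [ringChar_eq_of_card_eq_prime hp hF]; omega
    have h3 : ringChar F ≠ 3 := by rw [ringChar_eq_of_card_eq_prime hp hF]; omega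
    exact E.abs_natCard_point_sub_le_of_ringChar_ne h2 h3

/-- **The local Ramanujan bound** at every prime `p` of `ℚ`: the coefficients `cₖ` of `1 / L_p(T)`
for an elliptic curve `E / ℚ` satisfy `|cₖ| ≤ (k + 1) p^{k/2}` (`abs_coeff_localPowerSeries_le`
fed with Hasse's bound `abs_natCard_point_sub_le_of_card_eq_prime` for the reduction of the
minimal model, an elliptic curve over `𝔽_p` at good `p`). [folklore] -/
theorem abs_coeff_localPowerSeries_le_sqrt (W : WeierstrassCurve ℚ) [W.IsElliptic] (k : ℕ) :
    |((PowerSeries.coeff k ((W.baseChange (v.adicCompletion ℚ)).localPowerSeries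
        (v.adicCompletionIntegers ℚ)) : ℤ) : ℝ)| ≤
      (k + 1) * Real.sqrt (primesEquiv v : ℕ) ^ k := by
  set R := v.adicCompletionIntegers ℚ
  have hq : Nat.card (IsLocalRing.ResidueField R) = (primesEquiv v : ℕ) :=
    natCard_residueField_adicCompletionIntegers v
  have hq1 : 1 < Nat.card (IsLocalRing.ResidueField R) := hq ▸ (primesEquiv v).2.one_lt
  haveI : Finite (IsLocalRing.ResidueField R) := Nat.finite_of_card_ne_zero (by omega)
  letI : Fintype (IsLocalRing.ResidueField R) := Fintype.ofFinite _
  have h := abs_coeff_localPowerSeries_le R (W.baseChange (v.adicCompletion ℚ)) ?_ hq1 k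
  · rwa [hq] at h
  intro hgood
  haveI hE : (((W.baseChange (v.adicCompletion ℚ)).minimal R).reduction R).IsElliptic :=
    (hasGoodReduction_iff_isElliptic_reduction R).mp hgood
  have hF : Fintype.card (IsLocalRing.ResidueField R) = (primesEquiv v : ℕ) := by
    rw [← Nat.card_eq_fintype_card, hq]
  have := abs_natCard_point_sub_le_of_card_eq_prime
    (((W.baseChange (v.adicCompletion ℚ)).minimal R).reduction R) (primesEquiv v).2 hF
  rwa [← Nat.card_eq_fintype_card] at this

/-- **`|a_{p^k}(E)| ≤ (k + 1) p^{k/2}`** for every prime `p` and `k ≥ 0`. [folklore] -/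
theorem abs_LFunction_prime_pow_le (W : WeierstrassCurve ℚ) [W.IsElliptic] {p : ℕ} (hp : p.Prime)
    (k : ℕ) : |(W.LFunction (p ^ k) : ℝ)| ≤ (k + 1) * Real.sqrt p ^ k := by
  obtain ⟨v, rfl⟩ : ∃ v : HeightOneSpectrum (𝓞 ℚ), (primesEquiv v : ℕ) = p :=
    ⟨primesEquiv.symm ⟨p, hp⟩, by rw [Equiv.apply_symm_apply]⟩
  rw [W.LFunction_apply_prime_pow v k]
  exact abs_coeff_localPowerSeries_le_sqrt v W k

/-! ### The divisor-type bound `(k + 1) p^{k/2} ≤ 16 · p^{5k/8}` and the global bound -/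

/-- `(k + 1)^8 ≤ 2^{k + 32}` for all `k`. [folklore] -/
theorem succ_pow_eight_le (k : ℕ) : (k + 1) ^ 8 ≤ 2 ^ (k + 32) := by
  by_cases hk : k ≤ 15
  · calc (k + 1) ^ 8 ≤ 16 ^ 8 := Nat.pow_le_pow_left (by omega) 8
      _ = 2 ^ 32 := by norm_num
      _ ≤ 2 ^ (k + 32) := Nat.pow_le_pow_right (by norm_num) (by omega)
  · push Not at hk
    induction k with
    | zero => omega
    | succ j ih =>
      rcases Nat.lt_or_ge j 16 with hj | hj
      · interval_cases j <;> norm_num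
      · have ih' := ih hj
        -- `(j + 2)^8 ≤ 2 (j + 1)^8` since `17 (j + 2) ≤ 18 (j + 1)` and `18^8 ≤ 2 · 17^8`
        have h1 : 17 * (j + 2) ≤ 18 * (j + 1) := by omega
        have h2 : (17 * (j + 2)) ^ 8 ≤ (18 * (j + 1)) ^ 8 := Nat.pow_le_pow_left h1 8
        rw [mul_pow, mul_pow] at h2
        have h3 : 18 ^ 8 * (j + 1) ^ 8 ≤ 2 * 17 ^ 8 * (j + 1) ^ 8 :=
          Nat.mul_le_mul_right _ (by norm_num)
        have h4 : 17 ^ 8 * (j + 1 + 1) ^ 8 ≤ 17 ^ 8 * (2 * (j + 1) ^ 8) := by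
          calc 17 ^ 8 * (j + 1 + 1) ^ 8 = (17 * (j + 2)) ^ 8 := by rw [mul_pow]
            _ ≤ 18 ^ 8 * (j + 1) ^ 8 := by rw [← mul_pow]; exact Nat.pow_le_pow_left h1 8
            _ ≤ 2 * 17 ^ 8 * (j + 1) ^ 8 := h3
            _ = 17 ^ 8 * (2 * (j + 1) ^ 8) := by ring
        have h5 : (j + 1 + 1) ^ 8 ≤ 2 * (j + 1) ^ 8 := Nat.le_of_mul_le_mul_left h4 (by norm_num)
        calc (j + 1 + 1) ^ 8 ≤ 2 * (j + 1) ^ 8 := h5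
          _ ≤ 2 * 2 ^ (j + 32) := Nat.mul_le_mul_left 2 ih'
          _ = 2 ^ (j + 1 + 32) := by ring

/-- `k + 1 ≤ 16 · 2^{k/8}` (real exponent). [folklore] -/
theorem succ_le_sixteen_mul_two_rpow (k : ℕ) : (k + 1 : ℝ) ≤ 16 * (2 : ℝ) ^ ((k : ℝ) / 8) := by
  have h := succ_pow_eight_le k
  have hR : (16 * (2 : ℝ) ^ ((k : ℝ) / 8)) ^ (8 : ℕ) = ((2 ^ (k + 32) : ℕ) : ℝ) := by
    rw [mul_pow, ← Real.rpow_natCast ((2 : ℝ) ^ ((k : ℝ) / 8)) 8, ← Real.rpow_mul (by norm_num),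
      show (k : ℝ) / 8 * ((8 : ℕ) : ℝ) = ((k : ℕ) : ℝ) by push_cast; ring, Real.rpow_natCast]
    push_cast
    ring
  have h' : ((k + 1 : ℕ) : ℝ) ^ (8 : ℕ) ≤ (16 * (2 : ℝ) ^ ((k : ℝ) / 8)) ^ (8 : ℕ) := by
    rw [hR]; exact_mod_cast h
  have := le_of_pow_le_pow_left₀ (by norm_num : (8 : ℕ) ≠ 0) (by positivity) h'
  exact_mod_cast this

/-- **Local step**: `(k + 1) (√p)^k ≤ B_p · (p^k)^{5/8}` with `B_p = 16` for `p < 256` and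
`B_p = 1` for `p ≥ 256` (there `p^{k/8} ≥ 2^k ≥ k + 1`). [folklore] -/
theorem succ_mul_sqrt_pow_le {p : ℕ} (hp : p.Prime) (k : ℕ) :
    (k + 1 : ℝ) * Real.sqrt p ^ k ≤
      (if p < 256 then (16 : ℝ) else 1) * (((p : ℝ) ^ k) ^ (5 / 8 : ℝ)) := by
  have hp0 : (0 : ℝ) ≤ p := Nat.cast_nonneg _
  have hp2 : (2 : ℝ) ≤ p := by exact_mod_cast hp.two_le
  -- `(√p)^k = (p^k)^{1/2}` and `(p^k)^{5/8} = (p^k)^{1/2} (p^k)^{1/8}`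
  have hsqrt : Real.sqrt p ^ k = ((p : ℝ) ^ k) ^ (1 / 2 : ℝ) := by
    rw [Real.sqrt_eq_rpow, ← Real.rpow_natCast, ← Real.rpow_mul hp0, ← Real.rpow_natCast,
      ← Real.rpow_mul hp0]
    ring_nf
  have h58 : ((p : ℝ) ^ k) ^ (5 / 8 : ℝ) = ((p : ℝ) ^ k) ^ (1 / 2 : ℝ) * ((p : ℝ) ^ k) ^ (1 / 8 : ℝ) := by
    rw [← Real.rpow_add' (by positivity) (by norm_num)]; norm_num
  have hk8 : ((p : ℝ) ^ k) ^ (1 / 8 : ℝ) = (p : ℝ) ^ ((k : ℝ) / 8) := by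
    rw [← Real.rpow_natCast, ← Real.rpow_mul hp0]; ring_nf
  rw [hsqrt, h58, hk8]
  have hhalf : 0 ≤ ((p : ℝ) ^ k) ^ (1 / 2 : ℝ) := by positivity
  -- it suffices: `k + 1 ≤ B_p p^{k/8}`
  suffices h : (k + 1 : ℝ) ≤ (if p < 256 then (16 : ℝ) else 1) * (p : ℝ) ^ ((k : ℝ) / 8) by
    calc (k + 1 : ℝ) * ((p : ℝ) ^ k) ^ (1 / 2 : ℝ)
        ≤ ((if p < 256 then (16 : ℝ) else 1) * (p : ℝ) ^ ((k : ℝ) / 8)) * ((p : ℝ) ^ k) ^ (1 / 2 : ℝ) :=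
          mul_le_mul_of_nonneg_right h hhalf
      _ = _ := by ring
  split_ifs with h256
  · calc (k + 1 : ℝ) ≤ 16 * (2 : ℝ) ^ ((k : ℝ) / 8) := succ_le_sixteen_mul_two_rpow k
      _ ≤ 16 * (p : ℝ) ^ ((k : ℝ) / 8) := by
          gcongr
  · push Not at h256
    have h256' : (256 : ℝ) ≤ p := by exact_mod_cast h256
    have hk2 : k + 1 ≤ 2 ^ k := Nat.lt_two_pow_self
    calc (k + 1 : ℝ) ≤ (2 : ℝ) ^ k := by exact_mod_cast hk2
      _ = (256 : ℝ) ^ ((k : ℝ) / 8) := by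
          rw [show (256 : ℝ) = 2 ^ (8 : ℝ) by norm_num, ← Real.rpow_mul (by norm_num),
            ← Real.rpow_natCast]
          ring_nf
      _ ≤ 1 * (p : ℝ) ^ ((k : ℝ) / 8) := by
          rw [one_mul]
          exact Real.rpow_le_rpow (by norm_num) h256' (by positivity)

/-- **The Ramanujan–Hasse bound for the Dirichlet coefficients of `L(E, s)`**, `E / ℚ` elliptic:
`|aₙ(E)| ≤ 16^{256} · n^{5/8}` for all `n` (indeed `|aₙ| ≤ d(n) √n`: multiplicativity,
`|a_{p^k}| ≤ (k + 1) p^{k/2}` from Hasse's bound at every `p`, and `(k + 1) ≤ 16 p^{k/8}`, `= 1·`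
for `p ≥ 256`) (Silverman, *AEC*, Thm. V.1.1 and §C.16; Deligne's bound is not needed in weight
`2` over `ℚ`). [folklore] -/
theorem abs_LFunction_le_rpow (W : WeierstrassCurve ℚ) [W.IsElliptic] (n : ℕ) :
    |(W.LFunction n : ℝ)| ≤ (16 : ℝ) ^ 256 * (n : ℝ) ^ (5 / 8 : ℝ) := by
  rcases Nat.eq_zero_or_pos n with rfl | hn
  · simp
  have hmult := W.isMultiplicative_LFunction
  rw [hmult.multiplicative_factorization W.LFunction hn.ne']
  -- `n^{5/8} = ∏ (p^k)^{5/8}`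
  have hcast : (n : ℝ) = ∏ p ∈ n.factorization.support, (p : ℝ) ^ n.factorization p := by
    conv_lhs => rw [← Nat.prod_factorization_pow_eq_self hn.ne']
    rw [Finsupp.prod, Nat.cast_prod]
    push_cast
    rfl
  have hn58 : (n : ℝ) ^ (5 / 8 : ℝ) =
      ∏ p ∈ n.factorization.support, (((p : ℝ) ^ n.factorization p) ^ (5 / 8 : ℝ)) := by
    rw [hcast, ← Real.finsetProd_rpow _ _ (fun p _ ↦ by positivity)]
  rw [hn58, Finsupp.prod, Int.cast_prod, Finset.abs_prod]
  -- the constants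
  set B : ℕ → ℝ := fun p ↦ if p < 256 then (16 : ℝ) else 1 with hB
  have hB1 : ∀ p, 1 ≤ B p := fun p ↦ by simp only [hB]; split_ifs <;> norm_num
  have hB16 : ∀ p, B p ≤ 16 := fun p ↦ by simp only [hB]; split_ifs <;> norm_num
  calc ∏ p ∈ n.factorization.support, |(W.LFunction (p ^ n.factorization p) : ℝ)|
      ≤ ∏ p ∈ n.factorization.support, B p * (((p : ℝ) ^ n.factorization p) ^ (5 / 8 : ℝ)) := by
        refine Finset.prod_le_prod (fun p _ ↦ abs_nonneg _) fun p hp ↦ ?_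
        have hpp : p.Prime := Nat.prime_of_mem_primeFactors (Nat.support_factorization n ▸ hp)
        exact (W.abs_LFunction_prime_pow_le hpp _).trans (succ_mul_sqrt_pow_le hpp _)
    _ = (∏ p ∈ n.factorization.support, B p) *
          ∏ p ∈ n.factorization.support, ((p : ℝ) ^ n.factorization p) ^ (5 / 8 : ℝ) :=
        Finset.prod_mul_distrib
    _ ≤ (16 : ℝ) ^ 256 * ∏ p ∈ n.factorization.support, ((p : ℝ) ^ n.factorization p) ^ (5 / 8 : ℝ) := by
        refine mul_le_mul_of_nonneg_right ?_ (Finset.prod_nonneg fun p _ ↦ by positivity)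
        -- only the primes `< 256` contribute a factor `16`
        rw [← Finset.prod_filter_mul_prod_filter_not _ (fun p ↦ p < 256)]
        have h2 : ∏ p ∈ n.factorization.support.filter (fun p ↦ ¬ p < 256), B p = 1 :=
          Finset.prod_eq_one fun p hp ↦ by
            simp only [hB, if_neg (Finset.mem_filter.mp hp).2]
        rw [h2, mul_one]
        calc ∏ p ∈ n.factorization.support.filter (fun p ↦ p < 256), B p
            ≤ ∏ p ∈ n.factorization.support.filter (fun p ↦ p < 256), (16 : ℝ) :=
              Finset.prod_le_prod (fun p _ ↦ by linarith [hB1 p]) fun p _ ↦ hB16 p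
          _ = 16 ^ (n.factorization.support.filter (fun p ↦ p < 256)).card := by
              rw [Finset.prod_const]
          _ ≤ 16 ^ 256 := by
              refine pow_le_pow_right₀ (by norm_num) ?_
              calc (n.factorization.support.filter (fun p ↦ p < 256)).card
                  ≤ (Finset.range 256).card := Finset.card_le_card fun p hp ↦
                    Finset.mem_range.mpr (Finset.mem_filter.mp hp).2
                _ = 256 := Finset.card_range 256

/-- The bound in the form consumed by `exists_wildChars_twistedSymbolSum_ne_zero`
(`PAdicLFunctionMomentProofs`): `‖(aₙ(E) : ℂ)‖ ≤ 16^{256} n^{5/8}`. [folklore] -/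
theorem norm_LFunction_le_rpow (W : WeierstrassCurve ℚ) [W.IsElliptic] (n : ℕ) :
    ‖((W.LFunction n : ℤ) : ℂ)‖ ≤ (16 : ℝ) ^ 256 * (n : ℝ) ^ (5 / 8 : ℝ) := by
  rw [Complex.norm_intCast]
  exact W.abs_LFunction_le_rpow n

end Rat

end WeierstrassCurve
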